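import Summits.ABC.ABC.Theorems.CongruentialReceptacleBalancedFreySzpiroStubThinWindowSwap
import Summits.ABC.ABC.Theorems.CongruentialReceptacleBalancedFreySzpiroStubThinWindowSplit
import Summits.ABC.ABC.Theorems.CongruentialReceptacleQuarterWindowGivesCrux
import Literature.NumberTheory.DiophantineGeometry.PastenSubexpTheorem14
import HarnessLib

/-!
# Thin-window rigidity for `BalancedFreySzpiro` — cores

Crux `BalancedFreySzpiro` (stmt-ABC-1723) of route CongruentialReceptacle, line `Descent` (card
`balance-window-descent`): THIN-WINDOW RIGIDITY — Szpiro's `6+ε` in elementary currency on the single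
near-isosceles window `62c ≤ 125a`, `62c ≤ 125b` implies the crux for every balance `κ > 0`. The
logarithmic abc bound `log c ≤ K + (1+ε) log rad(abc)` is transported along maps of abc triples acting
on the balance coordinate `t = a/c` by `P : t ↦ t(2-t)` (split), `Q : t ↦ t²` (swap-split-swap) and
`F : t ↦ (1-2t)²` (fold), each costing one halving `ε ↦ ε/(2+ε)`; a machine-found cover, certified in
exact rational arithmetic (each piece a chain of monotone interval steps closed by `norm_num`), moves
every `t ∈ [1/4, 1/2]` into `[62/125, 63/125]` along the ladder
`1/4 ← 7/16 ← 9/20 ← 23/50 ← 47/100 ← 12/25 ← 49/100 ← 99/200 ← 62/125` (15 pieces, 63 steps).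

This file: coordinate glue (`thinWindow_cast_c_pos`, `thinWindow_coord_lower`, `thinWindow_coord_b`,
`thinWindow_log_rad_nonneg`, `thinWindow_hyp_of_window`, `thinWindow_window_of_half`,
`thinWindow_lwi_of_le_one`), the derived transport `thinWindow_coreQ` along `t ↦ t²` (from the landed
stubs `stub_thinWindowSwap`, `stub_thinWindowSplit`; the fold `stub_thinWindowFold` is imported by the
stage files directly), and the interval bookkeeping
`thinWindow_bnd_P/Q/Fl/Fu` used by the certified stages. Elementary; no named facts. [folklore]
-/

set_option linter.dupNamespace false

noncomputable section

open Real
open Literature.NumberTheory.DiophantineGeometry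
open Summit.ABC.ABC.Theses.CongruentialReceptacle

namespace Summit.ABC.ABC.Theorems

/-! ### Glue: the balance coordinate `t = a/c` -/

/-- For an abc triple, `c > 0` (read in `ℝ`). [folklore] -/
theorem thinWindow_cast_c_pos {a b c : ℕ} (h : IsABCTriple a b c) : (0 : ℝ) < c := by
  obtain ⟨ha, -, habc, -⟩ := h
  have : 0 < c := by omega
  exact_mod_cast this

/-- `κc ≤ a` reads `κ ≤ a/c` in the balance coordinate. [folklore] -/
theorem thinWindow_coord_lower {κ : ℝ} {a b c : ℕ} (h : IsABCTriple a b c)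
    (ha : κ * (c : ℝ) ≤ (a : ℝ)) : κ ≤ (a : ℝ) / (c : ℝ) := by
  rw [le_div_iff₀ (thinWindow_cast_c_pos h)]
  exact ha

/-- The balance coordinate of the swapped triple: `b/c = 1 - a/c`. [folklore] -/
theorem thinWindow_coord_b {a b c : ℕ} (h : IsABCTriple a b c) :
    (b : ℝ) / (c : ℝ) = 1 - (a : ℝ) / (c : ℝ) := by
  have hc := (thinWindow_cast_c_pos h).ne'
  obtain ⟨-, -, habc, -⟩ := h
  rw [eq_sub_iff_add_eq, ← add_div, div_eq_one_iff_eq hc]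
  exact_mod_cast (by omega : b + a = c)

/-- `log rad(abc) ≥ 0`. [folklore] -/
theorem thinWindow_log_rad_nonneg (a b c : ℕ) : 0 ≤ Real.log ((rad a b c : ℕ) : ℝ) :=
  Real.log_nonneg (by exact_mod_cast Nat.one_le_iff_ne_zero.mpr (Nat.radical_pos _).ne')

/-- Window form ⟹ set form: the logarithmic abc bound for triples with `κc ≤ a`, `κc ≤ b` is the
bound for triples whose balance coordinate `a/c` lies in `[κ, 1-κ]`. [folklore] -/
theorem thinWindow_hyp_of_window {κ e K : ℝ}
    (H : ∀ a b c : ℕ, IsABCTriple a b c → κ * (c : ℝ) ≤ (a : ℝ) → κ * (c : ℝ) ≤ (b : ℝ) →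
      Real.log (c : ℝ) ≤ K + (1 + e) * Real.log ((rad a b c : ℕ) : ℝ)) :
    ∀ a b c : ℕ, IsABCTriple a b c → (a : ℝ) / (c : ℝ) ∈ Set.Icc κ (1 - κ) →
      Real.log (c : ℝ) ≤ K + (1 + e) * Real.log ((rad a b c : ℕ) : ℝ) := by
  intro a b c h ht
  rw [Set.mem_Icc] at ht
  have hc := thinWindow_cast_c_pos h
  refine H a b c h ((le_div_iff₀ hc).mp ht.1) ?_
  have hb : κ ≤ (b : ℝ) / (c : ℝ) := by
    rw [thinWindow_coord_b h]
    linarith [ht.2]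
  exact (le_div_iff₀ hc).mp hb

/-- Half ⟹ window: by the symmetry `a ↔ b` (`rad(bac) = rad(abc)`) a bound proved for the window
triples with `a/c ≤ 1/2` holds on the whole window. [folklore] -/
theorem thinWindow_window_of_half {κ K e : ℝ}
    (Hh : ∀ a b c : ℕ, IsABCTriple a b c → κ * (c : ℝ) ≤ (a : ℝ) → (a : ℝ) / (c : ℝ) ≤ 1 / 2 →
      Real.log (c : ℝ) ≤ K + (1 + e) * Real.log ((rad a b c : ℕ) : ℝ)) :
    ∀ a b c : ℕ, IsABCTriple a b c → κ * (c : ℝ) ≤ (a : ℝ) → κ * (c : ℝ) ≤ (b : ℝ) →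
      Real.log (c : ℝ) ≤ K + (1 + e) * Real.log ((rad a b c : ℕ) : ℝ) := by
  intro a b c h ha hb
  by_cases hle : (a : ℝ) / (c : ℝ) ≤ 1 / 2
  · exact Hh a b c h ha hle
  · have hle' : (b : ℝ) / (c : ℝ) ≤ 1 / 2 := by
      rw [thinWindow_coord_b h]
      linarith [not_le.mp hle]
    have key := Hh b a c h.swap hb hle'
    rwa [rad_swap] at key

/-- WLOG `ε ≤ 1` in a logarithmic window statement (the slope `1 + ε` only weakens as `ε` grows,
since `log rad(abc) ≥ 0`). [folklore] -/
theorem thinWindow_lwi_of_le_one {κ : ℝ}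
    (H1 : ∀ ε : ℝ, 0 < ε → ε ≤ 1 → ∃ K : ℝ, 0 ≤ K ∧ ∀ a b c : ℕ, IsABCTriple a b c →
      κ * (c : ℝ) ≤ (a : ℝ) → κ * (c : ℝ) ≤ (b : ℝ) →
        Real.log (c : ℝ) ≤ K + (1 + ε) * Real.log ((rad a b c : ℕ) : ℝ)) :
    ∀ ε : ℝ, 0 < ε → ∃ K : ℝ, 0 ≤ K ∧ ∀ a b c : ℕ, IsABCTriple a b c →
      κ * (c : ℝ) ≤ (a : ℝ) → κ * (c : ℝ) ≤ (b : ℝ) →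
        Real.log (c : ℝ) ≤ K + (1 + ε) * Real.log ((rad a b c : ℕ) : ℝ) := by
  intro ε hε
  obtain ⟨K, hK, h⟩ := H1 (min ε 1) (lt_min hε one_pos) (min_le_right _ _)
  refine ⟨K, hK, fun a b c ht ha hb => (h a b c ht ha hb).trans ?_⟩
  have hL := thinWindow_log_rad_nonneg a b c
  have hm : 1 + min ε 1 ≤ 1 + ε := by linarith [min_le_left ε 1]
  linarith [mul_le_mul_of_nonneg_right hm hL]

/-! ### Derived transport: `t ↦ t²` (swap ∘ split ∘ swap) -/

/-- **Transport along `t ↦ t²`.** The split of the swapped triple is `(b(b+2a), a², c²)`; swapped back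
it has balance coordinate `(a/c)²`. From `stub_thinWindowSwap` and `stub_thinWindowSplit`. [folklore] -/
theorem thinWindow_coreQ {T : Set ℝ} {ε δ K' : ℝ} (hε : 0 < ε) (hε1 : ε ≤ 1)
    (hδ : δ = ε / (2 + ε)) (hK' : 0 ≤ K')
    (H : ∀ a b c : ℕ, IsABCTriple a b c → (a : ℝ) / (c : ℝ) ∈ T →
      Real.log (c : ℝ) ≤ K' + (1 + δ) * Real.log ((rad a b c : ℕ) : ℝ)) :
    ∀ a b c : ℕ, IsABCTriple a b c → (a : ℝ) / (c : ℝ) ∈ {t : ℝ | t ^ 2 ∈ T} →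
      Real.log (c : ℝ) ≤ 2 * K' + 5 + (1 + ε) * Real.log ((rad a b c : ℕ) : ℝ) := by
  intro a b c h ht
  have HP := stub_thinWindowSplit hε hε1 hδ hK' (stub_thinWindowSwap H)
  have hmem : (b : ℝ) / (c : ℝ) ∈ {t : ℝ | t * (2 - t) ∈ {t : ℝ | 1 - t ∈ T}} := by
    simp only [Set.mem_setOf_eq] at ht ⊢
    rw [thinWindow_coord_b h]
    convert ht using 2
    ring
  have key := HP b a c h.swap hmem
  rwa [rad_swap] at key

/-! ### Interval bookkeeping for the three maps -/

/-- `t ↦ t(2-t)` is increasing on `t ≤ 1`. [folklore] -/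
theorem thinWindow_bnd_P {x lo hi lo' hi' : ℝ} (h : lo ≤ x ∧ x ≤ hi) (h1 : hi ≤ 1)
    (hlo : lo' ≤ lo * (2 - lo)) (hhi : hi * (2 - hi) ≤ hi') :
    lo' ≤ x * (2 - x) ∧ x * (2 - x) ≤ hi' := by
  obtain ⟨hl, hh⟩ := h
  constructor
  · nlinarith [mul_nonneg (sub_nonneg.mpr hl) (show (0 : ℝ) ≤ 2 - x - lo by linarith)]
  · nlinarith [mul_nonneg (sub_nonneg.mpr hh) (show (0 : ℝ) ≤ 2 - hi - x by linarith)]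

/-- `t ↦ t²` is increasing on `t ≥ 0`. [folklore] -/
theorem thinWindow_bnd_Q {x lo hi lo' hi' : ℝ} (h : lo ≤ x ∧ x ≤ hi) (h0 : 0 ≤ lo)
    (hlo : lo' ≤ lo ^ 2) (hhi : hi ^ 2 ≤ hi') :
    lo' ≤ x ^ 2 ∧ x ^ 2 ≤ hi' := by
  obtain ⟨hl, hh⟩ := h
  exact ⟨hlo.trans (pow_le_pow_left₀ h0 hl 2), (pow_le_pow_left₀ (h0.trans hl) hh 2).trans hhi⟩

/-- `t ↦ (1-2t)²` is decreasing on `t < 1/2`. [folklore] -/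
theorem thinWindow_bnd_Fl {x lo hi lo' hi' : ℝ} (h : lo ≤ x ∧ x ≤ hi) (h1 : hi < 1 / 2)
    (hlo : lo' ≤ (1 - 2 * hi) ^ 2) (hhi : (1 - 2 * lo) ^ 2 ≤ hi') :
    lo' ≤ (1 - 2 * x) ^ 2 ∧ (1 - 2 * x) ^ 2 ≤ hi' := by
  obtain ⟨hl, hh⟩ := h
  refine ⟨hlo.trans (pow_le_pow_left₀ (by linarith) (by linarith) 2),
    (pow_le_pow_left₀ (by linarith) (by linarith) 2).trans hhi⟩

/-- `t ↦ (1-2t)²` is increasing on `t > 1/2`. [folklore] -/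
theorem thinWindow_bnd_Fu {x lo hi lo' hi' : ℝ} (h : lo ≤ x ∧ x ≤ hi) (h0 : 1 / 2 < lo)
    (hlo : lo' ≤ (1 - 2 * lo) ^ 2) (hhi : (1 - 2 * hi) ^ 2 ≤ hi') :
    lo' ≤ (1 - 2 * x) ^ 2 ∧ (1 - 2 * x) ^ 2 ≤ hi' := by
  obtain ⟨hl, hh⟩ := h
  constructor
  · nlinarith [mul_nonneg (sub_nonneg.mpr hl) (show (0 : ℝ) ≤ x + lo - 1 by linarith)]
  · nlinarith [mul_nonneg (sub_nonneg.mpr hh) (show (0 : ℝ) ≤ hi + x - 1 by linarith)]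

end Summit.ABC.ABC.Theorems

end
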